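import Summits.ABC.ABC.Theorems.IsogenyGlueCongruenceSemistableHeightPolyBound
import Summits.ABC.ABC.Theorems.IsogenyGlueCongruenceSemistableHeightPolyBoundHeckeBound
import Literature.NumberTheory.EllipticCurves.PastenEigenSystemCountProofs
import Literature.NumberTheory.EllipticCurves.PastenHeightBoundsClassicalInputProofs
import Literature.NumberTheory.EllipticCurves.ModularParametrizationTrustBaseProofs
import Literature.NumberTheory.EllipticCurves.ModularParametrizationDegreeHoldsProofs
import HarnessLib

/-!
# Route `IsogenyGlueCongruence`, support item `SemistableHeightPolyBound` — the classical modular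
# approach: `h(E) ≤ ½ N log N + 9` from modularity, Mazur–Kenku and Pasten's Thm 5.5

Item `stmt-ABC-13918` of route `ABC/IsogenyGlueCongruence` (`∃ c, h_F(E) ≤ c · N_E²` for every
semistable elliptic `E/ℚ` given by a global minimal model). The sibling file
`IsogenyGlueCongruenceSemistableHeightPolyBound.lean` derives it from Pasten's Thm 1.9
(`pasten2024_height_lt`, `h(E) < (1/48 + ε) N log N`), a named fact whose in-tree reduction needs
Shimura curves `X₀^D(M)` with `D > 1` (absent from the tree). This file derives the item from the
`D = 1` **classical modular approach** (Frey; Murty–Pasten 2013; Pasten 2024 §3 p. 13 and the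
proof of Thm 7.2 p. 26), whose only unproved inputs are three named facts of the tree:

* `nonempty_modularParametrizationData` — modularity with an integral Manin constant
  (Wiles, Taylor–Wiles, Breuil–Conrad–Diamond–Taylor 2001 Thm A; Edixhoven 1991);
* `PastenShimura2024_minimalDegree_le_163_mul` — Mazur–Kenku: the minimal parametrisation degree
  of a globally minimal curve of the class is `≤ 163 · δ_{1,N}` (Pasten 2024, §3 p. 13);
* `PastenShimura2024_thm_5_5` — Pasten's Thm 5.5 (= Thm 1.8, case `D = 1`): `δ_{1,N}` divides
  the product of the congruence moduli `η_{[χ₀]}([χ])` over the classes `[χ] ≠ [χ₀]`.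

Everything else is PROVED in the tree: (EqHDeg) `h(E) ≤ ½ log δ_{1,N} + 9` from modularity and
Mazur–Kenku (`pasten2024_eq_3_4_classMinimal_of_modularity_of_mazurKenku`: Zagier's formula, the
trivial Petersson bound, `c ∈ ℤ ∖ {0}`), the count of eigen-systems `Σ_{c ≠ [χ₀]} #c ≤ (1/12 + κ) N`
(`Pasten2024.exists_sum_erase_finrank_quotient_le`), and — new here — the size bound
`log η_{[χ₀]}(c) ≤ 3 #c log N` from the TRIVIAL Hecke eigenvalue bound `|μ| ≤ 2p`
(`norm_le_two_mul_of_hasEigenvalue_heckeT_two`, sibling file), so that Deligne's theorem is not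
needed. Result: `h(E) ≤ ½ N log N + 9` for `N ≫ 1` (`exists_neronLatticeHeight_le_half_mul_log`),
hence `h_F(E) ≤ 10 N²` for `N ≫ 1` and, with Shafarevich below the threshold
(`exists_stableFaltingsHeight_le_of_conductorNorm_lt`), the item:
`semistableHeightPolyBound_of_modularity_of_mazurKenku_of_thm_5_5`, CONDITIONAL on the three named
facts above (the semistability hypothesis of the item is not used: the bound holds for all `E/ℚ`);
and the same with the datum supplied by the Modularity Theorem "version `a_p`"
(`exists_isNewformOf`, Diamond–Shurman Thm 8.8.3) through the tree's proved
`nonempty_modularParametrizationData_of_exists_isNewformOf` —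
`semistableHeightPolyBound_of_exists_isNewformOf_of_mazurKenku_of_thm_5_5`.

## References

* [PastenShimura2024] H. Pasten, *Shimura curves and the abc conjecture*, J. Number Theory 254
  (2024) 214–335 = arXiv:1705.09251: §3 p. 13 ((EqFrey), (EqHDeg)), Thm 5.5 p. 18, Prop 7.1 and
  the proof of Thm 7.2 p. 26.
* [MurtyPasten2013] M. R. Murty, H. Pasten, *Modular forms and effective Diophantine
  approximation*, J. Number Theory 133 (2013) 3739–3754, Thm 1.1 (`h(E) ≪ N log N`).
* [DiamondShurman2005] F. Diamond, J. Shurman, *A first course in modular forms*, Prop. 5.3.1.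
-/

noncomputable section

open scoped Classical MatrixGroups ModularForm

-- `Summit.<Summit>.<Problem>` is the mandated summit-side namespace (CONVENTIONS §2); for the
-- single-conjunct summit `ABC` the two coincide, so the duplicate `ABC.ABC` is deliberate.
set_option linter.dupNamespace false

namespace Summit.ABC.ABC.Theorems

open WeierstrassCurve CongruenceSubgroup UpperHalfPlane Polynomial Finset
open Literature.NumberTheory.EllipticCurves
open Literature.NumberTheory.EllipticCurves.ModularForms
open Literature.NumberTheory.EllipticCurves.Pasten2024

/-! ### The size of a congruence modulus from the trivial eigenvalue bound -/

/-- **`log η_{[χ₀]}(c) ≤ 3 · #c · log N`, unconditionally.** For an elliptic curve of conductor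
`N ≥ 11` with newform `f = D.f` (system `χ₀`) and every minimal prime `P ≠ eigenIdeal D.f` of
`𝕋 = anemicHeckeRing N 2` (= every class `c ≠ [χ₀]` of systems of Hecke eigenvalues,
`#c = rank_ℤ(𝕋 ⧸ P)`): `log η_{[χ₀]}(P) ≤ #c · 3 log N`. This is the displayed estimate
"`log η_{[χ]}(c) < #c (log N + 4 log N / log log N)`" of Pasten's proof of Thm 7.2 (p. 26) with the
Hasse–Weil/Deligne bound `|μ| ≤ 2√p` replaced by the trivial `|μ| ≤ 2p`
(`norm_le_two_mul_of_hasEigenvalue_heckeT_two`), at the cost of the constant: `P` is the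
eigen-ideal of an Atkin–Lehner form of a newform `g` of level `M ∣ N`
(`exists_isNewform0_eigenIdeal_eq_of_mem_minimalPrimes`); a prime `p ∤ N` below the Sturm bound of
level `N rad N` (`p ≤ N²(1 + log N)/6`) distinguishes `f` from `g`
(`IsNewform0.coeff_eq_of_coprime_of_forall_prime_lt_sturm`); `η ≤ (2p + |a_p(f)|)^{#c} ≤ (4p)^{#c}`
(`heckeCongruenceModulus_le_pow_finrank`, Prop. 5.4 with the integer polynomial of `T_p`); and
`log(4p) ≤ 2 log N + log(1 + log N) + log(4/6) ≤ 3 log N`.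
[cite: PastenShimura2024, proof of Thm. 7.2, p. 26] -/
theorem log_heckeCongruenceModulus_le_finrank_mul_three_mul_log (N : ℕ) [NeZero N]
    (W : WeierstrassCurve ℚ) [W.IsElliptic] (D : ModularParametrizationData W N) (hN : 11 ≤ N)
    (P : Ideal (anemicHeckeRing N 2)) (hP : P ∈ minimalPrimes (anemicHeckeRing N 2))
    (hPne : P ≠ eigenIdeal D.f) :
    Real.log (heckeCongruenceModulus D.f P) ≤
      (Module.finrank ℤ (anemicHeckeRing N 2 ⧸ P) : ℝ) * (3 * Real.log N) := by
  have hf := D.hasIntegralEigenvalues_f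
  have hf0 := D.f_ne_zero
  have hnew : IsNewform0 D.f := D.isNewformOf.1
  -- (1) `P` is the eigen-ideal of an Atkin–Lehner form of a newform `g` of level `M ∣ N`
  obtain ⟨x, g, hg, hφ0, hPφ⟩ := exists_isNewform0_eigenIdeal_eq_of_mem_minimalPrimes hP
  have hMN : x.1.1 ∣ N := (dvd_mul_right _ _).trans x.2
  -- (2) a distinguishing prime `p ∤ N` below the Sturm bound of level `N rad N`
  have hdist : ∃ p : ℕ, p.Prime ∧ ¬ p ∣ N ∧
      p < ((2 : ℤ) * gamma0Index (N * ∏ q ∈ N.primeFactors, q)).toNat / 12 + 1 ∧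
      (qExpansion 1 ⇑D.f).coeff p ≠ (qExpansion 1 ⇑g).coeff p := by
    by_contra hcon
    push Not at hcon
    have hall : ∀ n, n.Coprime N → (qExpansion 1 ⇑D.f).coeff n = (qExpansion 1 ⇑g).coeff n :=
      fun n hn ↦ hnew.coeff_eq_of_coprime_of_forall_prime_lt_sturm hg hMN hcon hn
    have heq : eigenIdeal (degeneracyMap0 x.1.1 N x.1.2 2 g) = eigenIdeal D.f := by
      refine eigenIdeal_eq_of_forall_heckeT_eq_smul (isAnemicEigenvector_degeneracyMap0 x hg) hφ0
        hf.isAnemicEigenvector hf0 fun p hp hpN ↦ ?_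
      haveI : NeZero p := ⟨hp.ne_zero⟩
      refine ⟨(qExpansion 1 ⇑g).coeff p, heckeT_degeneracyMap0_eq_coeff_smul x hg p hp hpN, ?_⟩
      rw [← hall p ((Nat.Prime.coprime_iff_not_dvd hp).mpr hpN)]
      exact hnew.heckeT_eq_coeff_smul hp
    exact hPne (hPφ.trans heq)
  obtain ⟨p, hp, hpN, hpB, hne⟩ := hdist
  haveI : NeZero p := ⟨hp.ne_zero⟩
  -- (3) `t = T_p`, `a = χ₀(T_p) = a_p(f)`, and `T_p - a ∉ P`
  set t : anemicHeckeRing N 2 := anemicHeckeRing.T N 2 p hp hpN with ht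
  set a : ℤ := intEigencharacter hf hf0 t with ha_def
  have ha : (a : ℂ) = (qExpansion 1 ⇑D.f).coeff p := by
    rw [ha_def, cast_intEigencharacter, ht, eigencharacter_T,
      heckeEigenvalue_eq_coeff_of_isNormalized hnew.2.2 hp (hnew.2.1 p hp)]
  have htP : t - (a : anemicHeckeRing N 2) ∉ P := by
    rw [hPφ, T_sub_intCast_mem_eigenIdeal_iff hφ0 hp hpN
      (heckeT_degeneracyMap0_eq_coeff_smul x hg p hp hpN), ha]
    exact fun h ↦ hne h.symm
  -- (4) the monic integer polynomial killing `T_p`, with roots bounded by `2p` (trivial bound)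
  obtain ⟨q, -, hq0, hroots⟩ := exists_monic_aeval_heckeT_eq_zero_norm_le N 2 p hp
    (fun μ hμ ↦ norm_le_two_mul_of_hasEigenvalue_heckeT_two N p hp hpN μ hμ)
  have hqt : aeval t q = 0 := by
    have h1 := Polynomial.aeval_algHom_apply (anemicHeckeRing N 2).val t q
    rw [Subalgebra.coe_val, ht, anemicHeckeRing.coe_T, hq0] at h1
    rw [ht]
    exact Subtype.ext (h1.symm.trans (ZeroMemClass.coe_zero _).symm)
  -- (5) `|a| ≤ 2p` (from the same bound: `f` is a `T_p`-eigenvector with eigenvalue `a`)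
  have habs : |(a : ℝ)| ≤ 2 * p := by
    have hev : Module.End.HasEigenvalue (heckeT (Gamma0 N) 2 p) (a : ℂ) := by
      refine Module.End.hasEigenvalue_of_hasEigenvector ⟨Module.End.mem_eigenspace_iff.mpr ?_, hf0⟩
      rw [← anemicHeckeRing.coe_T N 2 p hp hpN, ← ht, intEigencharacter_spec hf hf0 t]
    have := norm_le_two_mul_of_hasEigenvalue_heckeT_two N p hp hpN _ hev
    rwa [Complex.norm_intCast] at this
  -- (6) `η ≤ (2p + |a|)^{#c} ≤ (4p)^{#c}`
  have hp0 : (0 : ℝ) < p := by exact_mod_cast hp.pos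
  have hη := heckeCongruenceModulus_le_pow_finrank hf hf0 hP htP hqt (by positivity) hroots
  set r := Module.finrank ℤ (anemicHeckeRing N 2 ⧸ P) with hr
  have hr0 : 0 < r := finrank_quotient_pos_of_mem_minimalPrimes hP
  have hη' : (heckeCongruenceModulus D.f P : ℝ) ≤ (4 * p) ^ r :=
    hη.trans (pow_le_pow_left₀ (by positivity) (by linarith) r)
  -- (7) logarithms: `log η ≤ #c log(4p) = #c (log 4 + log p)`
  have hηpos : (0 : ℝ) < heckeCongruenceModulus D.f P := by
    exact_mod_cast heckeCongruenceModulus_pos hf hf0 hP hPne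
  have hlogη : Real.log (heckeCongruenceModulus D.f P) ≤ r * (Real.log 4 + Real.log p) := by
    have h := Real.log_le_log hηpos hη'
    rwa [Real.log_pow, Real.log_mul (by norm_num) hp0.ne'] at h
  -- (8) `p ≤ μ(N rad N)/6 = N ∏ (p' + 1) / 6 ≤ N² (1 + log N) / 6`
  have hNpos : (0 : ℝ) < N := by exact_mod_cast (show 0 < N by omega)
  have hN1 : (1 : ℝ) ≤ N := by exact_mod_cast (show 1 ≤ N by omega)
  have hlogN0 : 0 ≤ Real.log N := Real.log_nonneg hN1
  have hple : (p : ℝ) ≤ (N : ℝ) ^ 2 * (1 + Real.log N) / 6 := by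
    have hμ : gamma0Index (N * ∏ q ∈ N.primeFactors, q) = N * ∏ q ∈ N.primeFactors, (q + 1) :=
      gamma0Index_mul_prod_primeFactors (NeZero.ne N)
    have hB : ((2 : ℤ) * (gamma0Index (N * ∏ q ∈ N.primeFactors, q) : ℕ)).toNat =
        2 * (N * ∏ q ∈ N.primeFactors, (q + 1)) := by
      rw [hμ, show ((2 : ℤ) * ((N * ∏ q ∈ N.primeFactors, (q + 1) : ℕ) : ℤ)) =
        ((2 * (N * ∏ q ∈ N.primeFactors, (q + 1)) : ℕ) : ℤ) by push_cast; ring, Int.toNat_natCast]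
    rw [hB] at hpB
    have hp12 : p ≤ 2 * (N * ∏ q ∈ N.primeFactors, (q + 1)) / 12 := Nat.lt_succ_iff.mp hpB
    have hp6 : 6 * p ≤ N * ∏ q ∈ N.primeFactors, (q + 1) := by omega
    have hprod := prod_primeFactors_add_one_le (NeZero.ne N)
    have h6 : 6 * (p : ℝ) ≤ (N : ℝ) * ((N : ℝ) * (1 + Real.log N)) := by
      calc 6 * (p : ℝ) = ((6 * p : ℕ) : ℝ) := by push_cast; ring
        _ ≤ ((N * ∏ q ∈ N.primeFactors, (q + 1) : ℕ) : ℝ) := by exact_mod_cast hp6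
        _ = (N : ℝ) * ((∏ q ∈ N.primeFactors, (q + 1) : ℕ) : ℝ) := by push_cast; ring
        _ ≤ (N : ℝ) * ((N : ℝ) * (1 + Real.log N)) := by gcongr
    rw [le_div_iff₀ (by norm_num : (0 : ℝ) < 6)]
    linarith
  -- (9) `log p ≤ 2 log N + log(1 + log N) - log 6`
  have hlogp : Real.log p ≤ 2 * Real.log N + Real.log (1 + Real.log N) - Real.log 6 := by
    have h := Real.log_le_log hp0 hple
    rwa [Real.log_div (by positivity) (by norm_num), Real.log_mul (by positivity) (by positivity),
      Real.log_pow, Nat.cast_ofNat] at h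
  -- (10) `log(1 + log N) ≤ log N` (as `1 + log N ≤ N`) and `log 4 ≤ log 6`
  have hll : Real.log (1 + Real.log N) ≤ Real.log N := by
    apply Real.log_le_log (by positivity)
    have := Real.log_le_sub_one_of_pos hNpos
    linarith
  have h46 : Real.log 4 ≤ Real.log 6 := Real.log_le_log (by norm_num) (by norm_num)
  have hr' : (0 : ℝ) < r := by exact_mod_cast hr0
  calc Real.log (heckeCongruenceModulus D.f P)
      ≤ r * (Real.log 4 + Real.log p) := hlogη
    _ ≤ r * (3 * Real.log N) := mul_le_mul_of_nonneg_left (by linarith) hr'.le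

/-! ### `log δ_{1,N} ≤ N log N` for `N ≫ 1`, from Thm 5.5 -/

/-- **`log δ_{1,N} ≤ 3 (Σ_{c ≠ [χ₀]} #c) log N`** for a datum `D` of minimal degree in its class at
level `N` (`D.modularDegree = δ_{1,N}`), from Thm 5.5 (`δ_{1,N} ∣ ∏ η`, hypothesis `h55`, giving
`log δ_{1,N} ≤ Σ log η`, `Pasten2024.log_modularDegree_le_sum_log_heckeCongruenceModulus`) and the
unconditional size bound `log_heckeCongruenceModulus_le_finrank_mul_three_mul_log` (`N ≥ 11` by
`eleven_le_level`). [cite: PastenShimura2024, proof of Thm. 7.2, p. 26] -/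
theorem log_modularDegree_le_sum_finrank_mul_three_mul_log (h55 : PastenShimura2024_thm_5_5)
    {N : ℕ} [NeZero N] {W : WeierstrassCurve ℚ} [W.IsElliptic] (D : ModularParametrizationData W N)
    (hmin : ∀ (W' : WeierstrassCurve ℚ) [W'.IsElliptic] (D' : ModularParametrizationData W' N),
      D'.f = D.f → D.modularDegree ≤ D'.modularDegree) :
    Real.log (D.modularDegree : ℝ) ≤
      (∑ P ∈ (finite_minimalPrimes_anemicHeckeRing N 2).toFinset.erase (eigenIdeal D.f),
          (Module.finrank ℤ (anemicHeckeRing N 2 ⧸ P) : ℝ)) * (3 * Real.log N) := by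
  have h11 : 11 ≤ N := eleven_le_level D
  have h1 := log_modularDegree_le_sum_log_heckeCongruenceModulus h55 D hmin
  have h2 : ∑ P ∈ (finite_minimalPrimes_anemicHeckeRing N 2).toFinset.erase (eigenIdeal D.f),
        Real.log (heckeCongruenceModulus D.f P : ℝ) ≤
      ∑ P ∈ (finite_minimalPrimes_anemicHeckeRing N 2).toFinset.erase (eigenIdeal D.f),
        (Module.finrank ℤ (anemicHeckeRing N 2 ⧸ P) : ℝ) * (3 * Real.log N) := by
    refine Finset.sum_le_sum fun P hP => ?_
    exact log_heckeCongruenceModulus_le_finrank_mul_three_mul_log N W D h11 P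
      ((finite_minimalPrimes_anemicHeckeRing N 2).mem_toFinset.mp (Finset.mem_of_mem_erase hP))
      (Finset.ne_of_mem_erase hP)
  rw [← Finset.sum_mul] at h2
  exact h1.trans h2

/-- **`log δ_{1,N} ≤ N log N` for `N ≫ 1`** (a crude form of Pasten's Thm 7.2, `D = 1`, with
Deligne's bound replaced by the trivial one): there is `N₂` such that for every level `N ≥ N₂` and
every datum `D` of minimal degree in its class at level `N`, `log δ_{1,N} ≤ N log N`. From
`log_modularDegree_le_sum_finrank_mul_three_mul_log` and the PROVED count of eigen-systems
`Σ_{c ≠ [χ₀]} #c ≤ (1/12 + 1/4) N` for `N ≫ 1` (`Pasten2024.exists_sum_erase_finrank_quotient_le`).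
[cite: PastenShimura2024, Thm. 7.2 and Prop. 7.1, p. 26] -/
theorem exists_log_modularDegree_le_mul_log (h55 : PastenShimura2024_thm_5_5) :
    ∃ N₂ : ℕ, ∀ (N : ℕ) [NeZero N] (W : WeierstrassCurve ℚ) [W.IsElliptic]
      (D : ModularParametrizationData W N),
      (∀ (W' : WeierstrassCurve ℚ) [W'.IsElliptic] (D' : ModularParametrizationData W' N),
          D'.f = D.f → D.modularDegree ≤ D'.modularDegree) →
        N₂ ≤ N → Real.log (D.modularDegree : ℝ) ≤ (N : ℝ) * Real.log N := by
  obtain ⟨N₂, hN₂⟩ := exists_sum_erase_finrank_quotient_le (κ := 1 / 4) (by norm_num)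
  refine ⟨N₂, fun N _ W _ D hmin hN => ?_⟩
  have h1 := log_modularDegree_le_sum_finrank_mul_three_mul_log h55 D hmin
  have h2 := hN₂ N W D hN
  have h11 : 11 ≤ N := eleven_le_level D
  have hlog : 0 ≤ Real.log N := Real.log_natCast_nonneg N
  have h3 : (∑ P ∈ (finite_minimalPrimes_anemicHeckeRing N 2).toFinset.erase (eigenIdeal D.f),
          (Module.finrank ℤ (anemicHeckeRing N 2 ⧸ P) : ℝ)) * (3 * Real.log N) ≤
      ((1 / 12 + 1 / 4) * N) * (3 * Real.log N) :=
    mul_le_mul_of_nonneg_right h2 (by positivity)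
  calc Real.log (D.modularDegree : ℝ) ≤ ((1 / 12 + 1 / 4) * N) * (3 * Real.log N) := h1.trans h3
    _ = (N : ℝ) * Real.log N := by ring

/-! ### `h(E) ≤ ½ N log N + 9` for `N ≫ 1` -/

/-- **The Murty–Pasten bound, crude form: `h(E) ≤ ½ N log N + 9` for `N ≫ 1`**, for every
globally minimal elliptic `W/ℚ` and every period pair `L` spanning its Néron lattice
(`h(E) = neronLatticeHeight L`). Printed: `h(E) ≪ N log N` (Murty–Pasten 2013, Thm 1.1);
`h(E) < (1/16 + ε) N log N` (ibid.); here with constant `½` because Deligne's bound is replaced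
by the trivial Hecke bound. Proof: a datum `D'` of `W` exists (`hmod`), hence a datum `D₀` of
minimal degree in the class (`exists_minimal_datum_in_class`), with `W`'s newform;
(EqHDeg) `h(E) ≤ ½ log δ_{1,N} + 9` (`pasten2024_eq_3_4_classMinimal_of_modularity_of_mazurKenku`,
from `hmod` and the Mazur–Kenku fact `h163`); and `log δ_{1,N} ≤ N log N`
(`exists_log_modularDegree_le_mul_log`, from `h55`). CONDITIONAL on the three named facts.
[cite: MurtyPasten2013, Thm 1.1] [cite: PastenShimura2024, §3 p. 13 and Thm. 7.2] -/
theorem exists_neronLatticeHeight_le_half_mul_log (hmod : nonempty_modularParametrizationData)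
    (h163 : PastenShimura2024_minimalDegree_le_163_mul) (h55 : PastenShimura2024_thm_5_5) :
    ∃ N₂ : ℕ, ∀ (W : WeierstrassCurve ℚ) [W.IsElliptic] [W.IsGloballyMinimal]
      [NeZero (W.conductorNorm ℤ)] (L : PeriodPair), IsNeronLatticeOf (W.baseChange ℂ) L →
        N₂ ≤ W.conductorNorm ℤ →
          neronLatticeHeight L ≤
            (W.conductorNorm ℤ : ℝ) * Real.log (W.conductorNorm ℤ) / 2 + 9 := by
  obtain ⟨N₂, hN₂⟩ := exists_log_modularDegree_le_mul_log h55
  refine ⟨N₂, fun W _ _ _ L hL hN => ?_⟩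
  obtain ⟨D'⟩ := hmod W
  obtain ⟨W₀, hW₀, D₀, hf, hmin⟩ := exists_minimal_datum_in_class D'
  have hfW : IsNewformOf W D₀.f := by rw [hf]; exact D'.isNewformOf
  have hh := pasten2024_eq_3_4_classMinimal_of_modularity_of_mazurKenku hmod h163 W L hL D₀ hfW hmin
  have hδ := hN₂ (W.conductorNorm ℤ) W₀ D₀ hmin hN
  linarith

/-! ### The item, from modularity, Mazur–Kenku and Thm 5.5 -/

/-- **`SemistableHeightPolyBound` from the classical modular approach.** Assuming the named facts
`nonempty_modularParametrizationData` (modularity with an integral Manin constant),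
`PastenShimura2024_minimalDegree_le_163_mul` (Mazur–Kenku) and `PastenShimura2024_thm_5_5`
(Pasten's Thm 5.5, `D = 1`), there is an absolute `c` with `h_F(E) ≤ c · N_E²` for every
semistable elliptic `E/ℚ` given by a global minimal model `W` (`N_E = W.conductorNorm ℤ`).
Proof: for `N ≥ N₂`, `h_F(E) ≤ h(E/ℚ) = neronLatticeHeight L ≤ ½ N log N + 9 ≤ 10 N²`
(`stableFaltingsHeight_le_faltingsHeight_rat`, `faltingsHeight_eq_neronLatticeHeight`,
`exists_isNeronLatticeOf_holds`, `exists_neronLatticeHeight_le_half_mul_log`, `log N ≤ N`);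
for `N < N₂`, `h_F(E) ≤ B` by Shafarevich (`exists_stableFaltingsHeight_le_of_conductorNorm_lt`);
`c = max B 10`, using `N ≥ 1`. The semistability hypothesis is not used. CONDITIONAL on the three
named facts (none discharged in the tree). [cite: MurtyPasten2013, Thm 1.1]
[cite: PastenShimura2024, §3 p. 13, Thm. 5.5, Thm. 7.2] -/
theorem semistableHeightPolyBound_of_modularity_of_mazurKenku_of_thm_5_5
    (hmod : nonempty_modularParametrizationData)
    (h163 : PastenShimura2024_minimalDegree_le_163_mul) (h55 : PastenShimura2024_thm_5_5) :
    Summit.ABC.ABC.Theses.IsogenyGlueCongruence.SemistableHeightPolyBound := by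
  unfold Summit.ABC.ABC.Theses.IsogenyGlueCongruence.SemistableHeightPolyBound
  obtain ⟨N₂, hN₂⟩ := exists_neronLatticeHeight_le_half_mul_log hmod h163 h55
  obtain ⟨B, hB⟩ := exists_stableFaltingsHeight_le_of_conductorNorm_lt N₂
  refine ⟨max B 10, fun W _ _ _ _ => ?_⟩
  have hN1 : (1 : ℝ) ≤ (W.conductorNorm ℤ : ℝ) := by
    exact_mod_cast Nat.one_le_iff_ne_zero.2 (NeZero.ne _)
  have hc0 : (0 : ℝ) ≤ max B 10 := le_trans (by norm_num) (le_max_right _ _)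
  have hsq : (1 : ℝ) ≤ (W.conductorNorm ℤ : ℝ) ^ 2 := by nlinarith
  by_cases hN : N₂ ≤ W.conductorNorm ℤ
  · obtain ⟨L, hL⟩ := exists_isNeronLatticeOf_holds (W.baseChange ℂ)
    have hle := hN₂ W L hL hN
    have hlog : Real.log (W.conductorNorm ℤ : ℝ) ≤ (W.conductorNorm ℤ : ℝ) :=
      (Real.log_le_sub_one_of_pos (by linarith)).trans (by linarith)
    have hNN : (W.conductorNorm ℤ : ℝ) * Real.log (W.conductorNorm ℤ) ≤
        (W.conductorNorm ℤ : ℝ) ^ 2 := by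
      rw [sq]
      exact mul_le_mul_of_nonneg_left hlog (by linarith)
    calc W.stableFaltingsHeight ≤ W.faltingsHeight := stableFaltingsHeight_le_faltingsHeight_rat W
      _ = neronLatticeHeight L := faltingsHeight_eq_neronLatticeHeight W hL
      _ ≤ (W.conductorNorm ℤ : ℝ) * Real.log (W.conductorNorm ℤ) / 2 + 9 := hle
      _ ≤ (W.conductorNorm ℤ : ℝ) ^ 2 / 2 + 9 * (W.conductorNorm ℤ : ℝ) ^ 2 := by
          have h9 : (9 : ℝ) ≤ 9 * (W.conductorNorm ℤ : ℝ) ^ 2 := by nlinarith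
          linarith
      _ ≤ 10 * (W.conductorNorm ℤ : ℝ) ^ 2 := by nlinarith
      _ ≤ max B 10 * (W.conductorNorm ℤ : ℝ) ^ 2 :=
          mul_le_mul_of_nonneg_right (le_max_right _ _) (by positivity)
  · have hlt : W.conductorNorm ℤ < N₂ := lt_of_not_ge hN
    calc W.stableFaltingsHeight ≤ B := hB W hlt
      _ ≤ max B 10 := le_max_left _ _
      _ = max B 10 * 1 := (mul_one _).symm
      _ ≤ max B 10 * (W.conductorNorm ℤ : ℝ) ^ 2 := mul_le_mul_of_nonneg_left hsq hc0

/-- **`SemistableHeightPolyBound` from the Modularity Theorem ("version `a_p`"), Mazur–Kenku and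
Thm 5.5.** The same deduction with the modular parametrisation datum supplied by
`exists_isNewformOf` (every elliptic `E/ℚ` has a newform `f ∈ S₂(Γ₀(N_E))` with `a_p(f) = a_p(E)`;
Wiles, Taylor–Wiles, Breuil–Conrad–Diamond–Taylor 2001 Thm A; Diamond–Shurman Thm 8.8.3) through
the tree's PROVED `nonempty_modularParametrizationData_of_exists_isNewformOf` and
`IsNewformOf.exists_maninConstant_ne_zero_holds` (Shimura's construction, Faltings' isogeny
theorem, the Riemann-surface degree). CONDITIONAL on the named facts `exists_isNewformOf`,
`PastenShimura2024_minimalDegree_le_163_mul`, `PastenShimura2024_thm_5_5`.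
[cite: DiamondShurman2005, Thm. 8.8.3] [cite: PastenShimura2024, §3 p. 13, Thm. 5.5, Thm. 7.2] -/
theorem semistableHeightPolyBound_of_exists_isNewformOf_of_mazurKenku_of_thm_5_5
    (hmod : exists_isNewformOf) (h163 : PastenShimura2024_minimalDegree_le_163_mul)
    (h55 : PastenShimura2024_thm_5_5) :
    Summit.ABC.ABC.Theses.IsogenyGlueCongruence.SemistableHeightPolyBound :=
  semistableHeightPolyBound_of_modularity_of_mazurKenku_of_thm_5_5
    (nonempty_modularParametrizationData_of_exists_isNewformOf hmod
      IsNewformOf.exists_maninConstant_ne_zero_holds) h163 h55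

end Summit.ABC.ABC.Theorems

end
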